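import Mathlib.LinearAlgebra.BilinearForm.Orthogonal
import Literature.AlgebraicGeometry.HodgeTheory.LocallyTrivialExtensionClasses
import Summits.HodgeConjecture.HodgeConjecture.Theorems.LinearSystemTorelliLocalTubeSpanFramePartial
import Summits.HodgeConjecture.HodgeConjecture.Theorems.LinearSystemTorelliLocalTubeSpanTransvections

/-!
# Route LinearSystemTorelli — crux `LocalTubeSpan`: partial frame theorem on the span of a cluster

Helper file (`--supports stmt-HodgeConjecture-2490`, line `Sketch`, stub `stub_framePartialOnSpan`).
At a MIXED point of the discriminant the local monodromy group `G = ⟨s⟩` acts on the vanishing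
cohomology `V` by Picard–Lefschetz transvections `t(x) = x - B(x, e_t) e_t` of the alternating
intersection form; a sub-family `s₁ ⊆ s` (the meridians of ONE Janssen-complete cluster) has its
cycles in the cluster lattice `L₁ = ℚ e(s₁)` and off its radical `R₁ = L₁ ∩ L₁^⊥`, while the other
generators' cycles are orthogonal to `L₁` (transversal nodes).  This file transports the partial
frame theorem of `LinearSystemTorelliLocalTubeSpanFramePartial` to that setting:

* `localTubeSpan_exists_sub_eq_of_frame_on_span_partial` — a linearly independent frame `δ'_i`
  realised by transvections `u_i ∈ ⟨s₁⟩` such that every `t ∈ s₁` has a positive power agreeing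
  ON `L₁` with an element of the frame group (finite index in the image of `⟨s₁⟩ → GL(L₁)`: Schnell's
  Lemma 11 / Janssen for the complete orbit) forces every undetected cocycle to be a coboundary on
  `s₁`: `φ(t) = t·v - v` for `t ∈ s₁` and one vector `v`.

Proof: the discrepancy `κ = γ⁻¹ t^m` lies in `⟨s₁⟩`, so `(κ - 1)V ⊆ L₁`; it fixes `L₁` pointwise
and is an isometry, hence `(κ - 1)V ⊆ R₁`; `R₁` is fixed by every generator (cluster meridians by
`R₁ ⊆ L₁^⊥`, nodes by orthogonality), and no cluster cycle lies in `R₁`; so the partial frame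
theorem applies with `M = R₁`.  Reference: C. Schnell, *Primitive cohomology and the tube
mapping*, Math. Z. 268 (2010) §7 (proof of Prop. 12).  No named facts.
-/

-- `Summit.HodgeConjecture.HodgeConjecture.Theorems` is the mandated namespace (single-conjunct summit:
-- Sub = Summit), which `linter.dupNamespace` flags on every declaration; the lakefile turns the
-- linter off tree-wide (weak option), restated here so stand-alone elaboration is warning-free too.
set_option linter.dupNamespace false

noncomputable section

open CategoryTheory groupCohomology
open Literature.AlgebraicGeometry.HodgeTheory

namespace Summit.HodgeConjecture.HodgeConjecture.Theorems

section FramePartialSpan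

variable {G : Type} [Group G] (A : Rep.{0} ℚ G)

/-- Elements of the subgroup generated by transvections along cycles in a submodule `L` move every
vector into `L`: `(g - 1)V ⊆ L` for `g ∈ ⟨s₁⟩` when `(t - 1)V ⊆ L` for `t ∈ s₁`. [folklore] -/
theorem localTubeSpan_sub_mem_of_mem_closure (L : Submodule ℚ A.V) (s₁ : Set G)
    (hs₁ : ∀ t ∈ s₁, ∀ x : A.V, A.ρ t x - x ∈ L) {g : G} (hg : g ∈ Subgroup.closure s₁)
    (x : A.V) : A.ρ g x - x ∈ L := by
  induction hg using Subgroup.closure_induction generalizing x with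
  | mem t ht => exact hs₁ t ht x
  | one => simp
  | mul g h _ _ ihg ihh =>
      have e : A.ρ (g * h) x - x = (A.ρ g (A.ρ h x) - A.ρ h x) + (A.ρ h x - x) := by
        rw [map_mul, Module.End.mul_apply]; abel
      rw [e]
      exact L.add_mem (ihg _) (ihh _)
  | inv g _ ih =>
      have e : A.ρ g⁻¹ x - x = -(A.ρ g (A.ρ g⁻¹ x) - A.ρ g⁻¹ x) := by
        rw [← Module.End.mul_apply, ← map_mul, mul_inv_cancel, map_one, Module.End.one_apply]
        abel
      rw [e]
      exact L.neg_mem (ih _)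

/-- **Partial frame theorem on the span of a cluster** (stub `stub_framePartialOnSpan` of line
`Sketch`; see the module docstring).  `G = ⟨s⟩` acts through transvections of an alternating `B`
along `e_t`; `s₁ ⊆ s` has its cycles off the radical of `L₁ = ℚe(s₁)` and the other cycles are
orthogonal to `L₁`; a linearly independent frame realised in `⟨s₁⟩` by transvections, with every
`t ∈ s₁` having a positive power that agrees on `L₁` with a frame-group element, makes every
undetected cocycle a coboundary on `s₁`. [cite: Schnell2010, §7 Prop. 12 (proof)] -/
theorem localTubeSpan_exists_sub_eq_of_frame_on_span_partial [FiniteDimensional ℚ A.V]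
    (B : LinearMap.BilinForm ℚ A.V) (hB : B.IsAlt) (s : Set G) (hs : Subgroup.closure s = ⊤)
    (e : G → A.V) (hPL : ∀ t ∈ s, ∀ x : A.V, A.ρ t x = x - B x (e t) • e t)
    (s₁ : Set G) (hs₁ : s₁ ⊆ s)
    (hnotR : ∀ t ∈ s₁, e t ∉ Submodule.span ℚ (e '' s₁) ⊓ B.orthogonal (Submodule.span ℚ (e '' s₁)))
    (hout : ∀ t ∈ s \ s₁, ∀ y ∈ Submodule.span ℚ (e '' s₁), B y (e t) = 0)
    {r : ℕ} (u : Fin r → G) (hu₁ : ∀ i, u i ∈ Subgroup.closure s₁) (δ' : Fin r → A.V)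
    (hli : LinearIndependent ℚ δ')
    (hu : ∀ (i : Fin r) (x : A.V), A.ρ (u i) x = x - B x (δ' i) • δ' i)
    (hvirtL : ∀ t ∈ s₁, ∃ m : ℕ, 0 < m ∧ ∃ γ ∈ Subgroup.closure (Set.range u),
      ∀ x ∈ Submodule.span ℚ (e '' s₁), A.ρ (t ^ m) x = A.ρ γ x)
    (φ : cocycles₁ A) (hφ : ∀ g : G, (φ : G → A.V) g ∈ subOneRange A g) :
    ∃ v : A.V, ∀ t ∈ s₁, (φ : G → A.V) t = A.ρ t v - v := by
  classical
  -- isometries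
  have hiso : ∀ (g : G) (x y : A.V), B (A.ρ g x) (A.ρ g y) = B x y :=
    localTubeSpan_isometry_of_generators B A.ρ s hs fun t ht =>
      localTubeSpan_isometry_of_transvection_formula B hB (e t) (A.ρ t) (hPL t ht)
  -- the cluster lattice and its radical
  set L₁ : Submodule ℚ A.V := Submodule.span ℚ (e '' s₁) with hL₁
  set R₁ : Submodule ℚ A.V := L₁ ⊓ B.orthogonal L₁ with hR₁
  have hsubL₁ : ∀ g ∈ Subgroup.closure s₁, ∀ x : A.V, A.ρ g x - x ∈ L₁ := fun g hg x =>
    localTubeSpan_sub_mem_of_mem_closure A L₁ s₁ (fun t ht x => by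
      rw [hPL t (hs₁ ht), sub_sub_cancel_left, ← neg_smul]
      exact L₁.smul_mem _ (Submodule.subset_span ⟨t, ht, rfl⟩)) hg x
  -- `R₁` is fixed by every generator, hence `G`-stable
  have hRfixgen : ∀ t ∈ s, ∀ v ∈ R₁, A.ρ t v = v := by
    intro t ht v hv
    have h0 : B v (e t) = 0 := by
      by_cases ht₁ : t ∈ s₁
      · have h1 : B (e t) v = 0 :=
          (LinearMap.BilinForm.mem_orthogonal_iff.1 hv.2) _ (Submodule.subset_span ⟨t, ht₁, rfl⟩)
        rw [← hB.neg_eq, h1, neg_zero]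
      · exact hout t ⟨ht, ht₁⟩ v hv.1
    rw [hPL t ht, h0, zero_smul, sub_zero]
  have hRfix : ∀ (g : G), ∀ v ∈ R₁, A.ρ g v = v := by
    intro g v hv
    have hg : g ∈ Subgroup.closure s := by rw [hs]; exact Subgroup.mem_top g
    induction hg using Subgroup.closure_induction with
    | mem t ht => exact hRfixgen t ht v hv
    | one => simp
    | mul g h _ _ ihg ihh => rw [map_mul, Module.End.mul_apply, ihh, ihg]
    | inv g _ ih =>
        have := congrArg (A.ρ g⁻¹) ih
        rwa [← Module.End.mul_apply, ← map_mul, inv_mul_cancel, map_one, Module.End.one_apply,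
          eq_comm] at this
  have hRstab : ∀ (g : G), ∀ v ∈ R₁, A.ρ g v ∈ R₁ := fun g v hv => by
    rw [hRfix g v hv]; exact hv
  -- no cluster cycle lies in the radical: `ℚ·e_t ∩ R₁ = 0`
  have hMe : ∀ t ∈ s₁, (ℚ ∙ e t) ⊓ R₁ = ⊥ := fun t ht => by
    refine (Submodule.eq_bot_iff _).2 fun w hw => ?_
    obtain ⟨c, rfl⟩ := Submodule.mem_span_singleton.1 hw.1
    by_cases hc : c = 0
    · rw [hc, zero_smul]
    · exfalso
      refine hnotR t ht ?_
      have := R₁.smul_mem c⁻¹ hw.2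
      rwa [smul_smul, inv_mul_cancel₀ hc, one_smul] at this
  -- a positive power of `t ∈ s₁` lies in (frame group)·{κ | (κ - 1)V ⊆ R₁}
  have hvirt : ∀ t ∈ s₁, ∃ m : ℕ, 0 < m ∧
      t ^ m ∈ Subgroup.closure (Set.range u ∪ {κ : G | subOneRange A κ ≤ R₁}) := fun t ht => by
    obtain ⟨m, hmpos, γ, hγ, hγL⟩ := hvirtL t ht
    refine ⟨m, hmpos, ?_⟩
    have e1 : t ^ m = γ * (γ⁻¹ * t ^ m) := by group
    rw [e1]
    refine Subgroup.mul_mem _ (Subgroup.closure_mono Set.subset_union_left hγ)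
      (Subgroup.subset_closure (Or.inr ?_))
    -- `κ = γ⁻¹ t^m ∈ ⟨s₁⟩` acts trivially on `L₁`, is an isometry, and moves `V` into `L₁`
    have hγ₁ : γ ∈ Subgroup.closure s₁ :=
      (Subgroup.closure_le _).2 (by rintro _ ⟨i, rfl⟩; exact hu₁ i) hγ
    have hκ₁ : γ⁻¹ * t ^ m ∈ Subgroup.closure s₁ :=
      Subgroup.mul_mem _ (Subgroup.inv_mem _ hγ₁)
        (Subgroup.pow_mem _ (Subgroup.subset_closure ht) m)
    have hκL : ∀ x ∈ L₁, A.ρ (γ⁻¹ * t ^ m) x = x := fun x hx => by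
      rw [map_mul, Module.End.mul_apply, hγL x hx, ← Module.End.mul_apply, ← map_mul,
        inv_mul_cancel, map_one, Module.End.one_apply]
    rintro _ ⟨x, rfl⟩
    refine ⟨hsubL₁ _ hκ₁ x, LinearMap.BilinForm.mem_orthogonal_iff.2 fun y hy => ?_⟩
    rw [LinearMap.sub_apply, LinearMap.id_apply, map_sub]
    have e2 : B y (A.ρ (γ⁻¹ * t ^ m) x) = B y x := by
      calc B y (A.ρ (γ⁻¹ * t ^ m) x) = B (A.ρ (γ⁻¹ * t ^ m) y) (A.ρ (γ⁻¹ * t ^ m) x) := by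
            rw [hκL y hy]
        _ = B y x := hiso _ y x
    rw [e2, sub_self]
  -- apply the partial frame theorem with `M = R₁`
  obtain ⟨v, -, hv⟩ := localTubeSpan_exists_sub_eq_of_frame_partial A u δ' hli
    (fun i => localTubeSpan_range_sub_id_le_span_of_formula B (δ' i) (A.ρ (u i)) (hu i))
    R₁ hRstab s₁ e
    (fun t ht => localTubeSpan_range_sub_id_le_span_of_formula B (e t) (A.ρ t) (hPL t (hs₁ ht)))
    (fun t ht => by rw [hPL t (hs₁ ht), hB.self_eq_zero, zero_smul, sub_zero]) hMe hvirt φ hφ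
  exact ⟨v, hv⟩

end FramePartialSpan

end Summit.HodgeConjecture.HodgeConjecture.Theorems

end
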